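import Literature.NumberTheory.EllipticCurves.GreenbergSelmer
import Literature.NumberTheory.GaloisRepresentations.ContinuousH1
import HarnessLib

/-!
# Cocycle-level criteria for the tree's `H¹` maps: `resH1Hom`, `resOfLe`, `conjH1` (discrete modules)
# and `BigGaloisRep.resH1` (continuous representations) VANISH on an explicit class iff the pulled-back
# cocycle is PRINCIPAL — PROVED

Topic `Literature/NumberTheory/EllipticCurves`. Theorems only: no definition, no named fact, no
`sorry`, no instance, no notation. Cell `bsd-stepL`, seat `bsd-stepL-imc-p1` (g11): the dictionary
(module M3c, part 1) of the discharge plan `NOTE-prop323-Shapiro-discharge-plan-imc-p1-g11`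
([SkinnerUrban2014] Prop. 3.2.3, Shapiro for Selmer groups): the LOCAL CONDITIONS defining the tree's
Selmer groups — `GreenbergSelmer.awayKer` / `LocalDatum.strictKer` under all conjugates `conjH1 σ` on the
`K_∞`-side (`Castella2018.AcSelmer.selmerAc`), `BigGaloisRep.resH1 … (localMap K (Sum.inl w)) = 0` on
the big side (`BigGaloisRep.selmerBigDecomp`) — rewritten as statements about EXPLICIT cocycles
("the restricted / conjugated cocycle is a coboundary"), the currency of the Shapiro modules M1–M5a
(`BigRepModuleShapiro*Proofs.lean`).

* `resH1Hom_oneCocycleClass_eq_zero_iff` — `resH1Hom φ ψ h [z] = 0 ↔ ∃ n, ∀ x, ψ (z (φ x)) = x • n − n`.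
* `resOfLe_oneCocycleClass_eq_zero_iff` — restriction to a smaller subgroup.
* `conjH1_oneCocycleClass_mem_ker_resOfLe_iff` — `res_{H₁} (conj_σ [z]) = 0 ↔ ∃ a, ∀ x ∈ H₁,
  σ • z(σ⁻¹ x σ) = x • a − a` (so `conjH1 σ [z] ∈ awayKer H M v` is the case `H₁ = H ⊓ D_v`).
(The big-side counterpart `BigGaloisRep.resH1_oneCocycleClass_eq_zero_iff` — `resH1 ρ φ [c] = 0 ↔ the
restricted cocycle is principal — is ALREADY the tree's, `SelmerCocycleLiftUnramifiedFiniteProofs.lean`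
(defn-ty1 g4), and the `Γ_K`-specialised `resOfLe_oneCocycleClass_eq_zero_iff` is in
`SelmerGroupOverTorsionFinite.lean`; the versions here are generic over the ambient group, namespace
`CocycleCriteria`.)

HONEST FRAMING: unfoldings of Mathlib's `ContinuousCohomology.map` on explicit cocycles
(`map_oneCocycleClass`, `oneCocycleClass_eq_zero_iff`); nothing about elliptic curves or BSD.

References: [SerreGaloisCohomology1997] I §2.4–2.5 (compatible pairs, restriction, conjugation);
[NeukirchSchmidtWingberg2008] I §5.
-/

noncomputable section

open Literature.NumberTheory.GaloisRepresentations

namespace Literature.NumberTheory.EllipticCurves.CocycleCriteria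

universe u

/-! ## §1 Discrete modules: `resH1Hom`, `resOfLe`, `conjH1` -/

section Discrete

variable {G : Type u} [Group G] [TopologicalSpace G] [IsTopologicalGroup G]
  {M : Type u} [AddCommGroup M] [DistribMulAction G M] [TopologicalSpace M] [DiscreteTopology M]
  {G' : Type u} [Group G'] [TopologicalSpace G'] [IsTopologicalGroup G']
  {N : Type u} [AddCommGroup N] [DistribMulAction G' N] [TopologicalSpace N] [DiscreteTopology N]

/-- **`resH1Hom` on an explicit class vanishes iff the pulled-back cocycle is principal**:
`resH1Hom φ ψ h [z] = 0 ↔ ∃ n, ∀ x, ψ (z (φ x)) = x • n − n`.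
[cite: SerreGaloisCohomology1997, I §2.4 (compatible pairs)] -/
theorem resH1Hom_oneCocycleClass_eq_zero_iff (φ : G' →ₜ* G) (ψ : M →+ N)
    (h : ∀ (x : G') (m : M), ψ (φ x • m) = x • ψ m) (z : contOneCocycles (discreteTopRep G M)) :
    resH1Hom φ ψ h (oneCocycleClass _ z) = 0 ↔ ∃ n : N, ∀ x : G', ψ (z.1 (φ x)) = x • n - n := by
  change ContinuousCohomology.map φ (resHomOfEquivariant φ ψ h) 1 (oneCocycleClass _ z) = 0 ↔ _
  rw [map_oneCocycleClass, oneCocycleClass_eq_zero_iff]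
  rfl

/-- **Restriction to a smaller subgroup on an explicit class**: `resOfLe M hle [z] = 0 ↔
∃ a, ∀ x ∈ H₁, z x = x • a − a`. [cite: SerreGaloisCohomology1997, I §2.5 (restriction)] -/
theorem resOfLe_oneCocycleClass_eq_zero_iff {H₁ H₂ : Subgroup G} (hle : H₁ ≤ H₂)
    (z : contOneCocycles (discreteTopRep H₂ M)) :
    resOfLe M hle (oneCocycleClass _ z) = 0 ↔
      ∃ a : M, ∀ x : H₁, z.1 (Subgroup.inclusion hle x) = (x : G) • a - a :=
  resH1Hom_oneCocycleClass_eq_zero_iff _ _ _ z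

/-- **Conjugation then restriction on an explicit class**: for `H` normal, `σ ∈ G` and `H₁ ≤ H`,
`res_{H₁} (conj_σ [z]) = 0 ↔ ∃ a, ∀ x ∈ H₁, σ • z(σ⁻¹ x σ) = x • a − a` — in particular
`conjH1 H M σ [z] ∈ awayKer H M v` (`H₁ = H ⊓ D_v`) and `∈ strictKer` are statements about the cocycle
`x ↦ σ • z(σ⁻¹ x σ)`. [cite: SerreGaloisCohomology1997, I §2.5 (conjugation on `H¹(H, M)`)] -/
theorem conjH1_oneCocycleClass_mem_ker_resOfLe_iff {H H₁ : Subgroup G} [H.Normal] (hle : H₁ ≤ H)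
    (σ : G) (z : contOneCocycles (discreteTopRep H M)) :
    resOfLe M hle (conjH1 H M σ (oneCocycleClass _ z)) = 0 ↔
      ∃ a : M, ∀ x : H₁, σ • z.1 (subgroupConj H σ (Subgroup.inclusion hle x)) = (x : G) • a - a := by
  -- `conj_σ [z]` is the class of the cocycle `x ↦ σ • z(σ⁻¹ x σ)` (`map_oneCocycleClass`)
  change resOfLe M hle (ContinuousCohomology.map _ _ 1 (oneCocycleClass _ z)) = 0 ↔ _
  rw [map_oneCocycleClass, resOfLe_oneCocycleClass_eq_zero_iff]
  rfl

end Discrete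

end Literature.NumberTheory.EllipticCurves.CocycleCriteria

end
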